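import Summits.Ventures.PercRepro0.BoxEvents
import Mathlib.MeasureTheory.Integral.DominatedConvergence

/-!
# L3 · GHOST-LIMIT, kernel-checked against `Defs.lean` (seat p5): `M_d(p,h) → θ_d(p)` as `h ↓ 0`

Cell pub-perc-repro0, seat p2.  The magnetization `M_d(p,h) = E_p[1 − e^{−h|C(0)|}]` (with the
convention `e^{−h·∞} = 0` for `h > 0`, i.e. the integrand is `1` on `{0 ↔ ∞}`) of GLUE-p2-v2 L3, on the
cell's definitions:

* `measurable_clusterCard` : `ω ↦ |C(0)|` (as `ncard`, `0` on infinite clusters) is measurable;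
* `thetaI_le_M`   : `θ_d(p) ≤ M_d(p,h)` for `h ≥ 0` (L3(a));
* `tendsto_M`     : `M_d(p,h) → θ_d(p)` as `h → 0⁺` (L3(b), dominated convergence);
* `thetaI_eq_zero_of_M_le` : R2 — if `M_d(p,h) ≤ K h^a` for small `h > 0` (`a > 0`) then `θ_d(p) = 0`.

The ghost-vertex representation G6 (`M = P_{p,h}(0 ↔ 𝔤)`) is not formalised.
-/

open MeasureTheory ProbabilityTheory unitInterval
open scoped ENNReal Topology

namespace Summit.Ventures.PercRepro0.L2

open Summit.Ventures.PercRepro0.Defs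

variable {d : ℕ}

-- BEGIN BODY

/-! ### Measurability of the cluster size -/

/-- The event "the cluster of the origin is exactly the finite set `S`". -/
lemma measurableSet_cluster_eq (S : Finset (Vertex d)) :
    MeasurableSet {ω : Config d | cluster d ω 0 = ↑S} := by
  have : {ω : Config d | cluster d ω 0 = ↑S} =
      ⋂ x : Vertex d, {ω | Conn d ω 0 x ↔ x ∈ S} := by
    ext ω
    simp only [Set.mem_setOf_eq, Set.mem_iInter, Set.ext_iff, cluster, Finset.mem_coe]
  rw [this]
  refine MeasurableSet.iInter fun x => ?_
  by_cases hx : x ∈ S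
  · simp only [hx, iff_true]
    exact measurableSet_conn 0 x
  · simp only [hx, iff_false]
    exact (measurableSet_conn 0 x).compl

/-- `|C(0)|` as a natural number (`Set.ncard`, which is `0` on infinite clusters). -/
noncomputable def clusterCard (d : ℕ) (ω : Config d) : ℕ := (cluster d ω 0).ncard

/-- `ω ↦ |C(0)|` is measurable. -/
lemma measurable_clusterCard : Measurable (clusterCard d) := by
  refine measurable_to_countable' fun k => ?_
  have : clusterCard d ⁻¹' {k} =
      (⋃ S : Finset (Vertex d), ⋃ (_ : S.card = k), {ω | cluster d ω 0 = ↑S}) ∪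
        (if k = 0 then percolates d else ∅) := by
    ext ω
    simp only [Set.mem_preimage, Set.mem_singleton_iff, clusterCard, Set.mem_union, Set.mem_iUnion,
      exists_prop]
    constructor
    · intro hk
      by_cases hfin : (cluster d ω 0).Finite
      · left
        refine ⟨hfin.toFinset, ?_, by simp⟩
        rw [← hk, Set.ncard_eq_toFinset_card _ hfin]
      · right
        rw [Set.Infinite.ncard hfin] at hk
        subst hk
        rw [if_pos rfl]
        exact hfin
    · rintro (⟨S, hS, hω⟩ | hω)
      · rw [hω, Set.ncard_coe_finset, hS]
      · split_ifs at hω with hk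
        · subst hk
          exact Set.Infinite.ncard hω
        · exact absurd hω (Set.notMem_empty ω)
  rw [this]
  refine MeasurableSet.union (MeasurableSet.iUnion fun S => MeasurableSet.iUnion fun _ =>
    measurableSet_cluster_eq S) ?_
  split_ifs
  · exact measurableSet_percolates
  · exact MeasurableSet.empty

/-! ### The magnetization -/

open Classical in
/-- The ghost-field integrand `1 − e^{−h|C(0)|}`, equal to `1` on `{0 ↔ ∞}`. -/
noncomputable def ghostIntegrand (d : ℕ) (h : ℝ) (ω : Config d) : ℝ :=
  if ω ∈ percolates d then 1 else 1 - Real.exp (-h * clusterCard d ω)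

/-- The magnetization `M_d(p,h) = E_p[1 − e^{−h|C(0)|}]`. -/
noncomputable def M (d : ℕ) (p : I) (h : ℝ) : ℝ := ∫ ω, ghostIntegrand d h ω ∂(P d p)

/-- The integrand is measurable. -/
lemma measurable_ghostIntegrand (h : ℝ) : Measurable (ghostIntegrand d h) := by
  unfold ghostIntegrand
  refine Measurable.ite measurableSet_percolates measurable_const ?_
  have hcast : Measurable fun ω : Config d => (clusterCard d ω : ℝ) :=
    (measurable_from_nat (f := fun n : ℕ => (n : ℝ))).comp measurable_clusterCard
  exact measurable_const.sub ((measurable_const.mul hcast).exp)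

/-- For `h ≥ 0` the integrand lies in `[0,1]` and dominates the indicator of `{0 ↔ ∞}`. -/
lemma ghostIntegrand_bounds {h : ℝ} (hh : 0 ≤ h) (ω : Config d) :
    (percolates d).indicator (fun _ => (1 : ℝ)) ω ≤ ghostIntegrand d h ω ∧
      0 ≤ ghostIntegrand d h ω ∧ ghostIntegrand d h ω ≤ 1 := by
  unfold ghostIntegrand
  by_cases hω : ω ∈ percolates d
  · simp [hω]
  · simp only [hω, if_false, Set.indicator_of_notMem hω]
    have h1 : Real.exp (-h * clusterCard d ω) ≤ 1 := by
      rw [Real.exp_le_one_iff]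
      have : (0 : ℝ) ≤ clusterCard d ω := Nat.cast_nonneg _
      nlinarith
    have h2 : 0 < Real.exp (-h * clusterCard d ω) := Real.exp_pos _
    exact ⟨by linarith, by linarith, by linarith⟩

/-- L3(a): `θ_d(p) ≤ M_d(p,h)` for `h ≥ 0`. -/
theorem thetaI_le_M (p : I) {h : ℝ} (hh : 0 ≤ h) : thetaI d p ≤ M d p h := by
  have hint : Integrable (ghostIntegrand d h) (P d p) := by
    refine Integrable.of_bound (measurable_ghostIntegrand h).aestronglyMeasurable 1 ?_
    exact Filter.Eventually.of_forall fun ω => by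
      rw [Real.norm_eq_abs, abs_le]
      have := ghostIntegrand_bounds (d := d) hh ω
      exact ⟨by linarith [this.2.1], this.2.2⟩
  have hθ : thetaI d p = ∫ ω, (percolates d).indicator (fun _ => (1 : ℝ)) ω ∂(P d p) := by
    rw [integral_indicator_const (1 : ℝ) measurableSet_percolates, smul_eq_mul, mul_one,
      measureReal_def]
    rfl
  rw [hθ]
  refine integral_mono ?_ hint fun ω => (ghostIntegrand_bounds hh ω).1
  exact (integrable_const (1 : ℝ)).indicator measurableSet_percolates

/-- L3(b): `M_d(p,h) → θ_d(p)` as `h → 0⁺` (dominated convergence). -/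
theorem tendsto_M (p : I) : Filter.Tendsto (M d p) (𝓝[>] 0) (𝓝 (thetaI d p)) := by
  have hθ : thetaI d p = ∫ ω, (percolates d).indicator (fun _ => (1 : ℝ)) ω ∂(P d p) := by
    rw [integral_indicator_const (1 : ℝ) measurableSet_percolates, smul_eq_mul, mul_one,
      measureReal_def]
    rfl
  rw [hθ]
  refine tendsto_integral_filter_of_dominated_convergence (fun _ => (1 : ℝ)) ?_ ?_
    (integrable_const 1) ?_
  · exact Filter.Eventually.of_forall fun h => (measurable_ghostIntegrand h).aestronglyMeasurable
  · refine eventually_nhdsWithin_of_forall fun h (hh : 0 < h) => ?_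
    exact Filter.Eventually.of_forall fun ω => by
      rw [Real.norm_eq_abs, abs_le]
      have := ghostIntegrand_bounds (d := d) hh.le ω
      exact ⟨by linarith [this.2.1], this.2.2⟩
  · refine Filter.Eventually.of_forall fun ω => ?_
    unfold ghostIntegrand
    by_cases hω : ω ∈ percolates d
    · simp [hω]
    · simp only [hω, if_false, Set.indicator_of_notMem hω]
      have hcont : Continuous (fun h : ℝ => 1 - Real.exp (-h * clusterCard d ω)) := by fun_prop
      have := (hcont.tendsto 0).mono_left (nhdsWithin_le_nhds (s := Set.Ioi 0))
      simpa using this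

/-- R2: a bound `M_d(p,h) ≤ K h^a` for small `h > 0` (`a > 0`) forces `θ_d(p) = 0`. -/
theorem thetaI_eq_zero_of_M_le (p : I) {K a h₀ : ℝ} (ha : 0 < a) (hh₀ : 0 < h₀)
    (hM : ∀ h, 0 < h → h < h₀ → M d p h ≤ K * h ^ a) : thetaI d p = 0 := by
  refine le_antisymm ?_ (thetaI_nonneg d p)
  have hlim : Filter.Tendsto (fun h : ℝ => K * h ^ a) (𝓝[>] 0) (𝓝 0) := by
    have : Filter.Tendsto (fun h : ℝ => K * h ^ a) (𝓝[>] 0) (𝓝 (K * (0 : ℝ) ^ a)) :=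
      ((Real.continuousAt_rpow_const 0 a (Or.inr ha.le)).tendsto.const_mul K).mono_left nhdsWithin_le_nhds
    rwa [Real.zero_rpow ha.ne', mul_zero] at this
  refine le_of_tendsto_of_tendsto tendsto_const_nhds hlim ?_
  have hev : ∀ᶠ h in 𝓝[>] (0 : ℝ), h < h₀ := mem_nhdsWithin_of_mem_nhds (Iio_mem_nhds hh₀)
  filter_upwards [hev, self_mem_nhdsWithin] with h hlt hpos
  exact (thetaI_le_M p (le_of_lt hpos)).trans (hM h hpos hlt)

-- END BODY

end Summit.Ventures.PercRepro0.L2
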